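/-
Copyright (c) 2026. All rights reserved.
Released under Apache 2.0 license as described in the file LICENSE.
Authors: HodgeCM publication cell (pub-hodgecm), GR lane, seat GR-2 (`pub-hodgecm-own-hyp34`).
-/
import Literature.NumberTheory.GelbartRogawski1991.Prop311PrintedMpLeg
import Literature.NumberTheory.GelbartRogawski1991.Prop311RationalSplittingUnique
import HarnessLib

-- build-lane note (ops-buildfix G11b-3 recipe): dependent telescopes of the dual-pair datum; elaborate sequentially.
set_option Elab.async false

/-!
# [GelbartRogawski1991, §3.1 p. 454 L35–36] "`π` splits (uniquely) over `Sp_F(W)`" — EXISTENCE of the rational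
# splitting for the PRINTED objects, from a leg over the Darboux frame

Topic `NumberTheory/GelbartRogawski1991`; namespace `Literature.NumberTheory.GelbartRogawski1991.Prop311`.
Proved lemmas only; nothing of [GelbartRogawski1991] or [Weil1964] is asserted; `Prop311AsPrinted` is untouched.

The statement-exact typing `Prop311AsPrinted` carries "*It is known ([We]) that `π` splits uniquely over the group of
`F`-rational points `Sp_F(W)`. We denote this splitting by `i`.*" (p. 454 L35–36) as the binders
`(i) (_hi : IsRationalSplitting i) (_hi! : ∀ i', IsRationalSplitting i' → i' = i)`.  The UNIQUENESS half is the kernel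
theorem `Prop311RationalSplittingUnique.rationalSplitting_unique` (`_hi!` follows from `_hi`).  This file proves the
EXISTENCE half for every printed model `ρ` of `ρ_ψ` that is compared with the tree's smooth metaplectic model: the
smooth model CARRIES a rational section (the field `ratSplit` of the tree's splitting data, Weil's `r_F` read on
`Sp(𝕎_𝐀)` — `UnitaryDualPair.splittingDatum`, `Prop311PrintedDualPairLine.lineDatum`), and a homomorphism
`φ : Mp → Mp_𝐀(W)` over `(frameSp b)⁻¹` moves it to a rational splitting of the printed `π`:
`i := φ ∘ ratSplit ∘ (frameSpRat b) ∘ (ratSpEquiv)`.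

* §1 **`exists_isRationalSplitting_of_frame`**: for printed data `(F, E, σ, V, Φ)`, a `Φ`-orthogonal `E`-frame `b` with
  `Φ(bᵢ, bᵢ) = fᵢ δ`, `fᵢ ≠ 0`, ANY splitting datum `D` on `Sp(𝐀ᴺ × 𝐀ᴺ, alt (polar β_{T'}))`, `T' = T ⊗_F 𝐀`,
  `T = diag(-2 d fᵢ)`, with `Sp_F(W) = range (Weil1964.ratSp T')`, and a homomorphism `φ : Mp → Mp_𝐀(W)` over
  `(frameSp b)⁻¹`, the printed `π` HAS a rational splitting (no continuity and no compatible splitting needed);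
* §2 **`exists_isRationalSplitting_of_dualPairLine`** (the dual-pair datum with line second factor, Gram matrix `𝕋`) and
  **`exists_isRationalSplitting_of_darbouxLeg`** (a leg `φ₁ : Mp_ψ(𝐀ⁿ × 𝐀ⁿ, std)ᶜᵒⁿᵗ →* Mp_𝐀(W)` over the explicit
  Darboux frame `darbouxFrame b f e` of `Prop311PrintedMpLeg`);
* §3 **`existsUnique_isRationalSplitting_of_darbouxLeg`**: with `ρ` unitary and irreducible (printed binders `_hρu`,
  `_hρi`), `φ` non-degenerate and `Φ` skew, the rational splitting exists AND is unique — [GR91 p. 454 L35–36] for the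
  printed objects, modulo the comparison of metaplectic models (the `Mp` leg, not supplied here).

Consumers: the `i'`-binder of a model-independence transport (the conclusion of Prop. 3.1.1 for one printed model
implies it for any other) is discharged by §2 for every model carrying a leg.

## References
* [GelbartRogawski1991] S. Gelbart, J. Rogawski, Invent. Math. 105 (1991) 445–472, §3.1 p. 454 L17–42 (L35–36),
  Prop. 3.1.1 p. 455 L1–2.
* [Weil1964] A. Weil, Acta Math. 111 (1964) 143–211, Chap. III n° 40 (the "[We]" of p. 454 L35).
* [MoeglinVignerasWaldspurger1987] C. Mœglin, M.-F. Vignéras, J.-L. Waldspurger, LNM 1291 (1987), Chap. 2 II.1 (B).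
-/

set_option autoImplicit false

noncomputable section

open NumberField
open scoped TensorProduct Matrix Kronecker
open Literature.NumberTheory.Automorphic
open Literature.NumberTheory.Automorphic.UnitaryGroup
open Literature.RepresentationTheory.HeisenbergGroup
open Literature.NumberTheory.Weil1964

namespace Literature.NumberTheory.GelbartRogawski1991

namespace Prop311

open UnitaryDualPair

variable (F : Type) [Field F] [NumberField F]
variable (E : Type) [Field E] [NumberField E] [Algebra F E] [Algebra.IsQuadraticExtension F E]
variable (σ : E ≃ₐ[F] E) {δ : E} (hσδ : σ δ = -δ) (hδ : δ ≠ 0) {d : F} (hd : δ * δ = algebraMap F E d)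
variable (V : Type) [AddCommGroup V] [Module F V] [Module E V] [IsScalarTower F E V]
variable {n : ℕ} (b : Module.Basis (Fin n) E V)
variable (Φ : V →ₗ[F] V →ₗ[F] E) (f : Fin n → F)
variable {S : Type} [NormedAddCommGroup S] [InnerProductSpace ℂ S]
variable (ρ : Representation ℂ (AdelicHeisenberg F E V Φ) S)

/-! ## §1. A rational splitting of the printed `π` from a datum's rational section and a hom over `(frameSp b)⁻¹` -/

section Frame

/-- **EXISTENCE of a rational splitting of the printed `π : Mp_𝐀(W) → Sp_𝐀(W)` from the frame.**  Let `b` be a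
`Φ`-orthogonal `E`-basis with `Φ(bᵢ, bᵢ) = fᵢ δ`, `fᵢ ≠ 0`, `T = diag(-2 d fᵢ)`; let `D` be ANY splitting datum on
`Sp(𝐀ᴺ × 𝐀ᴺ, alt (polar β_{T'}))` (any spelling `T' = T ⊗_F 𝐀`, any `Mp`, any big group) whose `Sp_F(W)` is
`range (Weil1964.ratSp T')`, and `φ : Mp → Mp_𝐀(W)` a homomorphism over `(frameSp b)⁻¹` (pointwise:
`adelicFrame ∘ π(φ m) ∘ adelicFrame⁻¹ = π_D(m)`).  Then `φ ∘ i_D ∘ (frameSpRat b) ∘ ratSpEquiv` is a rational splitting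
of `π` in the sense of `Prop311AsPrinted` (`IsRationalSplitting`): "`π` splits over `Sp_F(W)`".
[cite: GelbartRogawski1991, §3.1 p. 454 L35–36; Weil1964, Chap. III n° 40] -/
theorem exists_isRationalSplitting_of_frame
    (hΦ₁ : ∀ (e : E) (x y : V), Φ (e • x) y = e * Φ x y) (hΦ₂ : ∀ (e : E) (x y : V), Φ x (e • y) = Φ x y * σ e)
    (hb : ∀ i j, i ≠ j → Φ (b i) (b j) = 0) (hf : ∀ i, Φ (b i) (b i) = algebraMap F E (f i) * δ) (hf0 : ∀ i, f i ≠ 0)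
    {T' : Matrix (Fin n) (Fin n) (AdeleRing (𝓞 F) F)}
    (hT'eq : T' = (symplecticGram F d f).map (algebraMap F (AdeleRing (𝓞 F) F))) (hT' : IsUnit T'.det)
    {Mp : Type*} [Group Mp] {GA : Type*} [Group GA]
    (D : SplittingDatum (symplecticGroup (polar (Weil1964.adelicForm F (Fin n) T'))) Mp GA)
    (hDsp : D.spRat = (Weil1964.ratSp F T' hT').range)
    (φ : Mp →* adelicMp F E V Φ ρ)
    (hproj : ∀ m : Mp,
      frameConj F E σ hσδ hδ hd V b ((proj F E V Φ ρ (φ m) : adelicSp F E V Φ) :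
          AdelicSpace F V ≃ₗ[AdeleRing (𝓞 F) F] AdelicSpace F V) =
        ((D.proj m : symplecticGroup (polar (Weil1964.adelicForm F (Fin n) T'))) :
          ((Fin n → AdeleRing (𝓞 F) F) × (Fin n → AdeleRing (𝓞 F) F)) ≃ₗ[AdeleRing (𝓞 F) F]
            ((Fin n → AdeleRing (𝓞 F) F) × (Fin n → AdeleRing (𝓞 F) F)))) :
    ∃ i : ratSp F E V Φ →* adelicMp F E V Φ ρ, IsRationalSplitting F E V Φ ρ i := by
  subst hT'eq
  have hT : IsUnit (symplecticGram F d f).det := isUnit_det_symplecticGram F f (d_ne_zero F E hδ hd) hf0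
  -- the isomorphism of the two `Sp_F(W)`, over `(frameSp b)⁻¹`
  let e₀ : D.spRat ≃* (ratSpToAdelic F E V Φ).range :=
    (MulEquiv.subgroupCongr hDsp).trans (frameSpRat F E σ hσδ hδ hd V b Φ f hΦ₁ hΦ₂ hb hf hT).symm
  have he₀ : ∀ x : D.spRat, ((e₀ x : (ratSpToAdelic F E V Φ).range) : adelicSp F E V Φ) =
      (frameSp F E σ hσδ hδ hd V b Φ f hΦ₁ hΦ₂ hb hf).symm (x : symplecticGroup (polar (framePairing F d f))) :=
    fun x => coe_frameSpRat_symm F E σ hσδ hδ hd V b Φ f hΦ₁ hΦ₂ hb hf hT _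
  -- `φ` lies over `(frameSp b)⁻¹`
  have hproj' : ∀ m : Mp, proj F E V Φ ρ (φ m) =
      (frameSp F E σ hσδ hδ hd V b Φ f hΦ₁ hΦ₂ hb hf).symm (D.proj m) := fun m => by
    rw [MulEquiv.eq_symm_apply]
    exact Subtype.ext (hproj m)
  -- the section `j := φ ∘ i_D ∘ e₀⁻¹` of `π` over `range (Sp_F(W) → Sp_𝐀(W))`
  let j : (ratSpToAdelic F E V Φ).range →* adelicMp F E V Φ ρ := (φ.comp D.ratSplit).comp e₀.symm.toMonoidHom
  have hj' : ∀ y, j y = φ (D.ratSplit (e₀.symm y)) := fun y => rfl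
  have hj : ∀ y : (ratSpToAdelic F E V Φ).range, proj F E V Φ ρ (j y) = (y : adelicSp F E V Φ) := fun y => by
    rw [hj', hproj', D.proj_ratSplit, ← he₀, MulEquiv.apply_symm_apply]
  -- read on `Sp_F(W)` itself
  refine ⟨j.comp (ratSpEquiv F E V Φ).toMonoidHom, fun g₀ => ?_⟩
  have happly : (j.comp (ratSpEquiv F E V Φ).toMonoidHom) g₀ = j (ratSpEquiv F E V Φ g₀) := rfl
  have h := hj (ratSpEquiv F E V Φ g₀)
  unfold projEnd
  rw [happly, h, coe_ratSpEquiv, coe_coe_ratSpToAdelic]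

end Frame

/-! ## §2. From the dual-pair datum with line second factor, and from a leg over the Darboux frame -/

section Leg

variable (e : Fin n × Fin 1 ≃ Fin n) (he : ∀ k : Fin n, (e.symm k).1 = k)

include he in
/-- **existence of the rational splitting from a hom over `(frameSp b)⁻¹` on the smooth model with Gram matrix `𝕋`**
(`𝕋 = adelicGram e T 1`, the dual-pair datum with line second factor; its rational section is Weil's `r_F`).
[cite: GelbartRogawski1991, §3.1 p. 454 L35–36; Weil1964, Chap. III n° 40] -/
theorem exists_isRationalSplitting_of_dualPairLine
    (hΦ₁ : ∀ (a : E) (x y : V), Φ (a • x) y = a * Φ x y) (hΦ₂ : ∀ (a : E) (x y : V), Φ x (a • y) = Φ x y * σ a)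
    (hb : ∀ i j, i ≠ j → Φ (b i) (b j) = 0) (hf : ∀ i, Φ (b i) (b i) = algebraMap F E (f i) * δ) (hf0 : ∀ i, f i ≠ 0)
    (hT : IsUnit (symplecticGram F d f).det)
    (φ : adelicMpCont F (Fin n) (UnitaryDualPair.adelicGram F e (symplecticGram F d f) (1 : Matrix (Fin 1) (Fin 1) F)) →*
      adelicMp F E V Φ ρ)
    (hproj : ∀ m,
      frameConj F E σ hσδ hδ hd V b ((proj F E V Φ ρ (φ m) : adelicSp F E V Φ) :
          AdelicSpace F V ≃ₗ[AdeleRing (𝓞 F) F] AdelicSpace F V) =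
        ((adelicMpCont.proj F (Fin n)
            (UnitaryDualPair.adelicGram F e (symplecticGram F d f) (1 : Matrix (Fin 1) (Fin 1) F)) m :
            symplecticGroup (polar (adelicForm F (Fin n)
              (UnitaryDualPair.adelicGram F e (symplecticGram F d f) (1 : Matrix (Fin 1) (Fin 1) F))))) :
          ((Fin n → AdeleRing (𝓞 F) F) × (Fin n → AdeleRing (𝓞 F) F)) ≃ₗ[AdeleRing (𝓞 F) F]
            ((Fin n → AdeleRing (𝓞 F) F) × (Fin n → AdeleRing (𝓞 F) F)))) :
    ∃ i : ratSp F E V Φ →* adelicMp F E V Φ ρ, IsRationalSplitting F E V Φ ρ i :=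
  exists_isRationalSplitting_of_frame F E σ hσδ hδ hd V b Φ f ρ hΦ₁ hΦ₂ hb hf hf0 (adelicGram_line F f e he)
    (UnitaryDualPair.isUnit_det_adelicGram F e hT (by rw [Matrix.det_one]; exact isUnit_one))
    (lineDatum F E σ hσδ hδ hd f e hT) rfl φ hproj

include he in
/-- **EXISTENCE of the rational splitting from a leg over the Darboux frame**: for printed data `(V, Φ, ρ)`, a
`Φ`-orthogonal frame `b` with `Φ(bᵢ, bᵢ) = fᵢ δ`, `φ = Tr Φ` non-degenerate, every homomorphism
`φ₁ : Mp_ψ(𝐀ⁿ × 𝐀ⁿ, std)ᶜᵒⁿᵗ →* Mp_𝐀(W)` lying over `darbouxFrame b f e` yields a rational splitting of `π` — the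
binder `_hi` of `Prop311AsPrinted` is inhabited. [cite: GelbartRogawski1991, §3.1 p. 454 L35–36; Weil1964, Chap. III n° 40] -/
theorem exists_isRationalSplitting_of_darbouxLeg
    (hΦ₁ : ∀ (a : E) (x y : V), Φ (a • x) y = a * Φ x y) (hΦ₂ : ∀ (a : E) (x y : V), Φ x (a • y) = Φ x y * σ a)
    (hb : ∀ i j, i ≠ j → Φ (b i) (b j) = 0) (hf : ∀ i, Φ (b i) (b i) = algebraMap F E (f i) * δ)
    (hφ : (traceForm F E V Φ).Nondegenerate) (hT : IsUnit (symplecticGram F d f).det)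
    (φ₁ : adelicMpCont F (Fin n) (1 : Matrix (Fin n) (Fin n) (AdeleRing (𝓞 F) F)) →* adelicMp F E V Φ ρ)
    (hproj₁ : ∀ (m₁ : adelicMpCont F (Fin n) (1 : Matrix (Fin n) (Fin n) (AdeleRing (𝓞 F) F)))
        (c : (Fin n → AdeleRing (𝓞 F) F) × (Fin n → AdeleRing (𝓞 F) F)),
      ((proj F E V Φ ρ (φ₁ m₁) : adelicSp F E V Φ) : AdelicSpace F V ≃ₗ[AdeleRing (𝓞 F) F] AdelicSpace F V)
          (darbouxFrame F E σ hσδ hδ hd V b f e hT c) =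
        darbouxFrame F E σ hσδ hδ hd V b f e hT
          (((adelicMpCont.proj F (Fin n) (1 : Matrix (Fin n) (Fin n) (AdeleRing (𝓞 F) F)) m₁ :
              symplecticGroup (polar (adelicForm F (Fin n) (1 : Matrix (Fin n) (Fin n) (AdeleRing (𝓞 F) F))))) :
            ((Fin n → AdeleRing (𝓞 F) F) × (Fin n → AdeleRing (𝓞 F) F)) ≃ₗ[AdeleRing (𝓞 F) F]
              ((Fin n → AdeleRing (𝓞 F) F) × (Fin n → AdeleRing (𝓞 F) F))) c)) :
    ∃ i : ratSp F E V Φ →* adelicMp F E V Φ ρ, IsRationalSplitting F E V Φ ρ i :=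
  exists_isRationalSplitting_of_dualPairLine F E σ hσδ hδ hd V b Φ f ρ e he hΦ₁ hΦ₂ hb hf
    (frame_ne_zero_of_nondegenerate F E σ V b Φ f hΦ₁ hΦ₂ hb hf hφ) hT (mpLeg F E V Φ f e hT ρ φ₁)
    (mpLeg_proj F E σ hσδ hδ hd V b Φ f e hT ρ φ₁ hproj₁)

end Leg

/-! ## §3. "`π` splits UNIQUELY over `Sp_F(W)`" for the printed objects, modulo the `Mp` leg -/

section Unique

variable (e : Fin n × Fin 1 ≃ Fin n) (he : ∀ k : Fin n, (e.symm k).1 = k)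
variable [CompleteSpace S]

include he in
/-- **[GR91 p. 454 L35–36] "`π` splits uniquely over the group of `F`-rational points `Sp_F(W)`" for the PRINTED
objects, modulo the `Mp` leg**: for printed data `(V, Φ)` (`Φ` skew: `Φ y x = -σ Φ x y`; `φ = Tr Φ` non-degenerate), a
printed model `ρ` of `ρ_ψ` (isometric, irreducible) and a homomorphism `φ₁ : Mp_ψ(𝐀ⁿ × 𝐀ⁿ, std)ᶜᵒⁿᵗ →* Mp_𝐀(W)` over
the Darboux frame of a `Φ`-orthogonal frame, there is EXACTLY ONE rational splitting `i` of `π` — existence by §2,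
uniqueness by `rationalSplitting_unique` (perfectness of `Sp_F(W)`, `ker π` central).
[cite: GelbartRogawski1991, §3.1 p. 454 L35–36; MoeglinVignerasWaldspurger1987, Chap. 2 II.1 (B)] -/
theorem existsUnique_isRationalSplitting_of_darbouxLeg
    (hΦ₁ : ∀ (a : E) (x y : V), Φ (a • x) y = a * Φ x y) (hΦ₂ : ∀ (a : E) (x y : V), Φ x (a • y) = Φ x y * σ a)
    (hΦ₃ : ∀ x y : V, Φ y x = -σ (Φ x y))
    (hb : ∀ i j, i ≠ j → Φ (b i) (b j) = 0) (hf : ∀ i, Φ (b i) (b i) = algebraMap F E (f i) * δ)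
    (hφ : (traceForm F E V Φ).Nondegenerate) (hT : IsUnit (symplecticGram F d f).det)
    (hρu : ∀ (h : AdelicHeisenberg F E V Φ) (v : S), ‖ρ h v‖ = ‖v‖)
    (hρi : ∀ K : Submodule ℂ S, IsClosed (K : Set S) →
      (∀ (h : AdelicHeisenberg F E V Φ), ∀ v ∈ K, ρ h v ∈ K) → K = ⊥ ∨ K = ⊤)
    (φ₁ : adelicMpCont F (Fin n) (1 : Matrix (Fin n) (Fin n) (AdeleRing (𝓞 F) F)) →* adelicMp F E V Φ ρ)
    (hproj₁ : ∀ (m₁ : adelicMpCont F (Fin n) (1 : Matrix (Fin n) (Fin n) (AdeleRing (𝓞 F) F)))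
        (c : (Fin n → AdeleRing (𝓞 F) F) × (Fin n → AdeleRing (𝓞 F) F)),
      ((proj F E V Φ ρ (φ₁ m₁) : adelicSp F E V Φ) : AdelicSpace F V ≃ₗ[AdeleRing (𝓞 F) F] AdelicSpace F V)
          (darbouxFrame F E σ hσδ hδ hd V b f e hT c) =
        darbouxFrame F E σ hσδ hδ hd V b f e hT
          (((adelicMpCont.proj F (Fin n) (1 : Matrix (Fin n) (Fin n) (AdeleRing (𝓞 F) F)) m₁ :
              symplecticGroup (polar (adelicForm F (Fin n) (1 : Matrix (Fin n) (Fin n) (AdeleRing (𝓞 F) F))))) :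
            ((Fin n → AdeleRing (𝓞 F) F) × (Fin n → AdeleRing (𝓞 F) F)) ≃ₗ[AdeleRing (𝓞 F) F]
              ((Fin n → AdeleRing (𝓞 F) F) × (Fin n → AdeleRing (𝓞 F) F))) c)) :
    ∃! i : ratSp F E V Φ →* adelicMp F E V Φ ρ, IsRationalSplitting F E V Φ ρ i :=
  haveI : FiniteDimensional E V := Module.Finite.of_basis b
  haveI : FiniteDimensional F V := finite_restrictScalars F E V
  existsUnique_of_exists_isRationalSplitting F E V Φ ρ σ hΦ₃ hφ hρu hρi
    (exists_isRationalSplitting_of_darbouxLeg F E σ hσδ hδ hd V b Φ f ρ e he hΦ₁ hΦ₂ hb hf hφ hT φ₁ hproj₁)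

end Unique

end Prop311

end Literature.NumberTheory.GelbartRogawski1991

end
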